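import Literature.NumberTheory.Automorphic.EssConjSelfDual
import Literature.NumberTheory.Automorphic.AutomorphicConjugate
import Literature.NumberTheory.Automorphic.AutomorphicRepsGLIrreducibleL2HCProofs
import Literature.NumberTheory.Automorphic.AutomorphicRepsGLSatakeDictionaryHolds
import Literature.NumberTheory.Automorphic.AutomorphicRepsGLShiftRealisation
import Literature.NumberTheory.Automorphic.StrongMultiplicityOneRepDataAE
import Literature.NumberTheory.Automorphic.AdelicGroupDataUniquenessProofs
import Literature.NumberTheory.Automorphic.WeaklyRegularGaloisRep
import Literature.NumberTheory.Automorphic.StrongMultiplicityOneGLOne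
import HarnessLib

/-!
# Conjugate self-duality in the pairing form from conjugate self-duality on Satake parameters:
# `JacquetShalika1981_isEssConjSelfDual_of_isConjSelfDualAE` from strong multiplicity one (pure proofs)

Topic `NumberTheory/Automorphic`; namespace `Literature.NumberTheory.Automorphic`. Proof file
(theorems only: no definition, no named fact, no instance) under the named fact
`JacquetShalika1981_isEssConjSelfDual_of_isConjSelfDualAE` of `WeaklyRegularGaloisRep` (for a CM
field `K` and a cuspidal Borel–Jacquet datum `P` on `GL_N(𝔸_K)`, `N ≥ 1`: if
`Sat(P, c w) = Sat(P, w)⁻¹` for almost all finite `w` — `IsConjSelfDualAE`, "`P^c ≅ P^∨` almost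
everywhere" — then `P^c ≅ P^∨` in the pairing form `IsEssConjSelfDual P 1` of `EssConjSelfDual`:
a bilinear form on `W / W'`, non-degenerate in each variable, invariant under `(c g, g)` on
`G(𝔸_f)`, on `K_∞` and infinitesimally on `𝔤`). The printed proof is "strong multiplicity one
(Jacquet–Shalika 1981 II, Thm. 4.4, with multiplicity one, Piatetski-Shapiro 1979) applied to `Π^c`
and `Π^∨`"; this file PROVES the fact from the tree's named fact
`strong_multiplicity_one_gl_sphericalLevel N K` (`JacquetLanglandsParts`; proved in the tree for
`N ≤ 1`, `StrongMultiplicityOneGLOne`, and reduced for `N ≥ 2` to Jacquet–Shalika's Rankin–Selberg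
facts in `StrongMultiplicityOneRankinSelberg`) — `JacquetShalika1981_isEssConjSelfDual_of_isConjSelfDualAE_of_smo`
— every other step being a theorem:

1. **The pairing from `U_σ(Π) = Π̄` in `L²`** (`CuspidalAutomorphicRepData.isGalConjEssSelfDual_one_of_galConj_eq_conj`,
   unconditional, any involution `σ ∈ Aut(K/F)`): for a clean cuspidal datum `π = V_Π / ⊥` whose forms
   are those of a cuspidal `Π ⊂ L²_cusp(GL_n(K) A_G \ GL_n(𝔸_K), μ)` (`formsOfL2`) with
   `U_σ(Π) = Π̄` (`CuspidalAutomorphicRepGL.galConj`, `AutomorphicGaloisConj`; `CuspidalAutomorphicRepGL.conj`,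
   `AutomorphicConjugate` — the conjugate `Π̄` realising the contragredient of the unitary `Π`), the form
   `B(x, y) = ⟪\overline{U_σ [x]}, [y]⟫_{L²}` (`[·]` the class map `IsL2LieStable.cl`) is invariant under
   `(σ g, g)` for all `g ∈ GL_n(𝔸_K)` (`galL2_rightRegular`, `rightRegular_conjL2`, unitarity of `R`),
   satisfies `B(X' ψ, φ) + B(ψ, X φ) = 0` whenever `exp tX' = σ exp tX` (the `L²`-derivative of the
   orbit of a class is the class of the Lie derivative, `IsL2LieStable.hasDerivAt_rightRegular_cl`,
   Harish-Chandra 1953), and is non-degenerate (the anti-unitary `J f = \overline{U_σ f}` maps `Π` onto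
   `Π`, and the classes of `V_Π` are dense in `Π`, `AutomorphicRepsGL.le_topologicalClosure_l2OfForms_formsOfL2`).
   Bump 1997, §4.2 (invariant bilinear forms and contragredients); Patrikis 2019, proof of
   Cor. 3.2.3 ("the `L²` inner product then implies that `π^∨ ≅ ^cπ`").
2. **Transfer along the clean model** (`AutomorphicRepData.IsShiftRealisation.isGalConjEssSelfDual`,
   unconditional): the pairing form transports along the isomorphism `C / ⊥ ≅ W / W'` of a shift
   realisation (`AutomorphicRepsGLShiftRealisation`, Borel–Jacquet 1979, 4.6 and 5.7).
3. **`s = 0` and `U_c(Π) = Π̄`** (`CuspidalAutomorphicRepData.exists_eq_formsOfL2_galConj_eq_conj_of_smo`,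
   from strong multiplicity one): normalising a clean `π₀` by `W₀ ⊗ |det|^s = V_Π`
   (`exists_twist_eq_formsOfL2_of_clean_eventually`), the hypothesis forces `s = 0` — the central
   characters `ω` of `Π` and `ω_c` of `U_c(Π)` (`exists_centralCharacter`) satisfy
   `(ω ω_c)(ϖ_w) = q_w^{-2ns}` almost everywhere, so `ω ω_c = ‖·‖^{2ns}`, trivial on `A_G`, so `s = 0` —
   and then `U_c(Π)`, `Π̄` have the common Satake parameter `t_{Π,w}⁻¹` at almost every spherical level
   (`HasSatakeParameterAt.galConj_principalCongruenceLevel`; `HasSatakeParameterAt.conj` with the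
   unitarity `\bar t_{Π,w} = t_{Π,w}⁻¹` of `HasSatakeParameterAt.map_conj_inv_eq`), whence `U_c(Π) = Π̄`
   by `strong_multiplicity_one_gl_sphericalLevel` (the proof follows
   `W_eq_of_isNearlyEquivalent_of_clean_of_smo` of `StrongMultiplicityOneRepDataAE` line by line).
4. **Assembly** (`CuspidalAutomorphicRepData.isEssConjSelfDual_one_of_isConjSelfDualAE_of_smo`,
   `JacquetShalika1981_isEssConjSelfDual_of_isConjSelfDualAE_of_smo`), and the unconditional rank-one
   case `…_rank_one` (`strong_multiplicity_one_gl_sphericalLevel_of_le_one`).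

## Design notes

* No new definition: the anti-unitary `J`, the class map and the forms are local to the proofs; the
  only top-level statements are theorems (two generic Hilbert-space lemmas, four private elementary
  lemmas — two of them copies of private lemmas of `StrongMultiplicityOneRepDataAE` —, and the five
  results above). Nothing restates or weakens the named fact: `…_of_smo` concludes it literally.
* The Galois automorphism is any involution `σ : K ≃ₐ[F] K` in §1–2 (so `σ = 1`, essential
  self-duality from `Π = Π̄`, is covered); §3–4 specialise to `c = NumberField.IsCMField.complexConj K`
  over `K⁺ = maximalRealSubfield K`, the automorphism of the fact.
* `set_option maxHeartbeats` (three long elaborations, commented in place); `open scoped Classical`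
  (H5: the place subtypes indexing `mixedSpace K` are `Fintype` classically).
* Deliberately NOT here: any discharge of `strong_multiplicity_one_gl_sphericalLevel` for `N ≥ 2`
  (Jacquet–Shalika's Rankin–Selberg theory; the trust base of the named fact is exactly that fact).

## References

* H. Jacquet, J. A. Shalika, *On Euler products and the classification of automorphic forms II*,
  Amer. J. Math. 103 (1981), 777–815, Thm. 4.4. [JacquetShalikaAJM1981II]
* I. I. Piatetski-Shapiro, *Multiplicity one theorems*, Proc. Sympos. Pure Math. 33 (1979), part 1,
  209–212. [PiatetskiShapiroCorvallis1979]
* D. Bump, *Automorphic forms and representations* (1997), §4.2. [Bump1997]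
* S. Patrikis, *Variations on a theorem of Tate*, Mem. AMS 258 (2019), Cor. 3.2.3. [Patrikis2019]
* A. Borel, H. Jacquet, *Automorphic forms and automorphic representations*, Proc. Sympos. Pure
  Math. 33 (1979), part 1, §4.6 and 5.7. [BorelJacquetCorvallis1979]
* Harish-Chandra, *Representations of a semisimple Lie group on a Banach space. I*, Trans. AMS 75
  (1953), §9 and Thm. 5. [HarishChandraTAMS1953]
-/

noncomputable section

-- (H5) `Classical`: the place subtypes indexing `mixedSpace K` are `Fintype` classically
open scoped MatrixGroups InnerProductSpace ComplexConjugate Classical NNReal Pointwise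
open NumberField IsDedekindDomain Filter
open _root_.MeasureTheory

namespace Literature.NumberTheory.Automorphic

open AdelicGroupData
open Literature.NumberTheory.GaloisRepresentations (HeckeCharacter)

/-! ### 0. Two Hilbert-space lemmas: orthogonality passes to the closure -/

section Hilbert

variable {E : Type*} [NormedAddCommGroup E] [InnerProductSpace ℂ E]

/-- If `⟪v, J u⟫ = 0` for all `u` in a subspace `S`, where `J` is additive, conjugate-homogeneous
and continuous (e.g. an anti-unitary), then `⟪v, J z⟫ = 0` for all `z` in the closure of `S`
(the set of such `z` is a closed subspace). [folklore] -/
theorem inner_apply_eq_zero_of_mem_topologicalClosure (J : E → E)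
    (hJadd : ∀ f g, J (f + g) = J f + J g) (hJsmul : ∀ (a : ℂ) f, J (a • f) = (starRingEnd ℂ a) • J f)
    (hJcont : Continuous J) (v : E) (S : Submodule ℂ E) (h : ∀ u ∈ S, ⟪v, J u⟫_ℂ = 0)
    {z : E} (hz : z ∈ S.topologicalClosure) : ⟪v, J z⟫_ℂ = 0 := by
  have hJzero : J 0 = 0 := by
    have h0 := hJsmul 0 0
    rwa [zero_smul, map_zero, zero_smul] at h0
  let T : Submodule ℂ E :=
    { carrier := {z | ⟪v, J z⟫_ℂ = 0}
      zero_mem' := by simp only [Set.mem_setOf_eq, hJzero, inner_zero_right]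
      add_mem' := fun {a b} ha hb => by
        simp only [Set.mem_setOf_eq] at ha hb ⊢
        rw [hJadd, inner_add_right, ha, hb, add_zero]
      smul_mem' := fun c a ha => by
        simp only [Set.mem_setOf_eq] at ha ⊢
        rw [hJsmul, inner_smul_right, ha, mul_zero] }
  have hTclosed : IsClosed (T : Set E) :=
    isClosed_eq (continuous_const.inner hJcont) continuous_const
  have hST : S ≤ T := fun u hu => h u hu
  exact Submodule.topologicalClosure_minimal S hST hTclosed hz

/-- If `⟪v, u⟫ = 0` for all `u` in a subspace `S` and `v` lies in the closure of `S`, then `v = 0`.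
[folklore] -/
theorem eq_zero_of_inner_eq_zero_of_mem_topologicalClosure (v : E) (S : Submodule ℂ E)
    (h : ∀ u ∈ S, ⟪v, u⟫_ℂ = 0) (hv : v ∈ S.topologicalClosure) : v = 0 := by
  let T : Submodule ℂ E :=
    { carrier := {z | ⟪v, z⟫_ℂ = 0}
      zero_mem' := by simp only [Set.mem_setOf_eq, inner_zero_right]
      add_mem' := fun {a b} ha hb => by
        simp only [Set.mem_setOf_eq] at ha hb ⊢
        rw [inner_add_right, ha, hb, add_zero]
      smul_mem' := fun c a ha => by
        simp only [Set.mem_setOf_eq] at ha ⊢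
        rw [inner_smul_right, ha, mul_zero] }
  have hTclosed : IsClosed (T : Set E) :=
    isClosed_eq (continuous_const.inner continuous_id) continuous_const
  have hST : S ≤ T := fun u hu => h u hu
  have key : ⟪v, v⟫_ℂ = 0 := Submodule.topologicalClosure_minimal S hST hTclosed hv
  exact inner_self_eq_zero.1 key

end Hilbert

/-! ### 1. The pairing `B(x, y) = ⟪\overline{U_σ [x]}, [y]⟫` on a clean datum realised in `L²` -/

section Pairing

variable {n : ℕ} {K : Type} [Field K] [NumberField K] {hcpt : isCompact_glFiniteIntegralLevel n K}
variable {F : Type*} [Field F] [Algebra F K]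
variable {μ : Measure (gl n K).automorphicQuotient} [(gl n K).IsAutomorphicMeasure μ]

-- one long elaboration (five clauses sharing the anti-unitary `J` and the class map): the default
-- heartbeat budget does not suffice (no `simp` search is involved)
set_option maxHeartbeats 800000 in
/-- **`Π^σ ≅ Π̄` in `L²_cusp` gives the pairing form of `π^σ ≅ π^∨`** for the Borel–Jacquet datum
`π = V_Π / ⊥` of `Π`. Let `σ ∈ Aut(K/F)` be an involution, `μ` an automorphic (hence `σ`-invariant,
`hμ`) measure, `Π ⊂ L²_cusp(GL_n(K) A_G \ GL_n(𝔸_K), μ)` cuspidal with `U_σ(Π) = Π̄`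
(`CuspidalAutomorphicRepGL.galConj … σ = CuspidalAutomorphicRepGL.conj`, i.e. `Π ∘ σ ≅ Π̃`, the
conjugate `Π̄` realising the contragredient of the unitary `Π`), and `π` a clean cuspidal datum
whose space of forms is `V_Π` (`formsOfL2`). Then `π` is essentially `σ`-conjugate self-dual with
trivial character (`IsGalConjEssSelfDual π σ 1`): the bilinear form
`B(x, y) = ⟪\overline{U_σ [x]}, [y]⟫_{L²} = ∫ x(σ g) y(g)` (`[·]` the class map, `U_σ [φ] = [φ ∘ σ⁻¹]`)
is invariant under `(σ g, g)` for every `g ∈ GL_n(𝔸_K)` (`U_σ R(σ g) = R(g) U_σ`, conjugation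
commutes with `R`, `R` is unitary), satisfies `B(X' ψ, φ) + B(ψ, X φ) = 0` when `exp tX' = σ exp tX`
(the `L²`-derivative of `t ↦ R(exp tX)[φ]` is `[X φ]`, Harish-Chandra), and is non-degenerate in
each variable (the anti-unitary `J = (f ↦ \overline{U_σ f})` maps `Π` onto `Π`, and the classes of
`V_Π` are dense in `Π`). This is the passage "`Π^c ≅ Π^∨` ⇒ invariant pairing `Π^c × Π → ℂ`"
(Bump 1997, §4.2; Patrikis 2019, proof of Cor. 3.2.3: "the `L²` inner product then implies that
`π^∨ ≅ ^cπ`") in the tree's function-space model. [cite: Bump1997, §4.2] -/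
theorem CuspidalAutomorphicRepData.isGalConjEssSelfDual_one_of_galConj_eq_conj
    (σ : K ≃ₐ[F] K) (hσ : σ * σ = 1) (hμ : IsGalInvariant F μ)
    (π : CuspidalAutomorphicRepData n K hcpt) (h0 : π.1.W' = ⊥)
    (P : CuspidalAutomorphicRepGL n K μ) (hW : π.1.W = formsOfL2 hcpt μ P.1)
    (hP : P.galConj F hμ σ = P.conj) : π.1.IsGalConjEssSelfDual σ 1 := by
  classical
  -- `V_Π` consists of `A_G`-invariant cusp forms, so it is `L²`-Lie-stable
  have hAG : ∀ φ ∈ π.1.W, ∀ z ∈ (gl n K).center', ∀ g : (gl n K).Adelic, φ (z * g) = φ g := by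
    intro φ hφ z hz g
    rw [hW] at hφ
    exact formsOfL2_center'_invariant P.1 hφ hz g
  have hL : IsL2LieStable (AutomorphyDatum.gl n K hcpt) μ π.1.W := IsL2LieStable.of_cuspidal_of_stable π.1.stable π.2 hAG
  -- the anti-unitary `J f = \overline{U_σ f}`
  set J : (gl n K).L2 μ → (gl n K).L2 μ := fun f => star (galL2 F hμ σ f) with hJ
  have hJadd : ∀ f g, J (f + g) = J f + J g := fun f g => by
    simp only [hJ, map_add, AdelicGroupData.L2.star_add]
  have hJsmul : ∀ (a : ℂ) (f : (gl n K).L2 μ), J (a • f) = (starRingEnd ℂ a) • J f := fun a f => by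
    simp only [hJ, map_smul, AdelicGroupData.L2.star_smul]
  have hJzero : J 0 = 0 := by
    have h := hJsmul 0 0
    rwa [zero_smul, map_zero, zero_smul] at h
  have hstar0 : star (0 : (gl n K).L2 μ) = 0 := by
    have h := AdelicGroupData.L2.star_smul (gl n K) μ 0 0
    rwa [zero_smul, map_zero, zero_smul] at h
  have hJinj : ∀ f, J f = 0 → f = 0 := by
    intro f hf
    have h1 : galL2 F hμ σ⁻¹ (star (J f)) = f := by
      simp only [hJ]
      rw [star_star, galL2_inv_galL2]
    rw [← h1, hf, hstar0, map_zero]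
  have hJcont : Continuous J :=
    ((gl n K).conjL2 μ).continuous.comp (galL2 F hμ σ).continuous
  have hσσ : ∀ g : (gl n K).Adelic, σ • σ • g = g := fun g => by rw [smul_smul, hσ, one_smul]
  have hJR : ∀ (g : (gl n K).Adelic) (f : (gl n K).L2 μ),
      J ((gl n K).rightRegular μ (σ • g) f) = (gl n K).rightRegular μ g (J f) := by
    intro g f
    simp only [hJ]
    rw [galL2_rightRegular, hσσ, ← AdelicGroupData.conjL2_apply, ← AdelicGroupData.conjL2_apply,
      AdelicGroupData.rightRegular_conjL2]
  -- `J` maps `Π` into `Π`, and onto `Π`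
  have hPP : (P.galConj F hμ σ).1 = P.1.conj := by rw [hP]; rfl
  have hJmem : ∀ f ∈ P.1, J f ∈ P.1 := by
    intro f hf
    have h1 : galL2 F hμ σ f ∈ (P.galConj F hμ σ).1 :=
      (ContRepresentation.ClosedSubrep.galL2_mem_galConj_iff F P.1 hμ σ).2 hf
    rw [hPP, ContRepresentation.ClosedSubrep.mem_conj_iff] at h1
    exact h1
  have hJsurj : ∀ w ∈ P.1, ∃ z ∈ P.1, J z = w := by
    intro w hw
    refine ⟨galL2 F hμ σ⁻¹ (star w), ?_, ?_⟩
    · have h1 : star w ∈ P.1.conj := by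
        rw [ContRepresentation.ClosedSubrep.mem_conj_iff, star_star]; exact hw
      rw [← hPP] at h1
      exact (ContRepresentation.ClosedSubrep.mem_galConj_iff F P.1 hμ σ).1 h1
    · simp only [hJ]
      rw [galL2_galL2_inv, star_star]
  -- the class map `cl : V_Π → L²` intertwines right translations and lands in `Π`
  have hclR : ∀ (g : (gl n K).Adelic) (φ : π.1.W)
      (hg : rightTranslation (gl n K) g (φ : (gl n K).Adelic → ℂ) ∈ π.1.W),
      hL.cl ⟨rightTranslation (gl n K) g φ, hg⟩ = (gl n K).rightRegular μ g (hL.cl φ) := by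
    intro g φ hg
    obtain ⟨f, hf, hfφ⟩ := hL.le_l2Representable φ.2
    have hf' : MemLp (fun y => f (g⁻¹ • y)) 2 μ :=
      hf.comp_measurePreserving (measurePreserving_smul g⁻¹ μ)
    rw [hL.cl_eq_toLp hf hfφ, hL.cl_eq_toLp hf' (by rw [invQuot_smul, hfφ]),
      AdelicGroupData.rightRegular_apply, DomMulAct.mk_smul_toLp]
  have hclP : ∀ φ : π.1.W, hL.cl φ ∈ P.1 := by
    intro φ
    have hφ : (φ : (gl n K).Adelic → ℂ) ∈ formsOfL2 hcpt μ P.1 := hW ▸ φ.2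
    obtain ⟨f, hf, hfP, hfφ, -⟩ := exists_toLp_mem_of_mem_formsOfL2 hφ
    rw [hL.cl_eq_toLp hf hfφ.symm]
    exact hfP
  -- density of the classes of `V_Π` in `Π`
  have hdense : P.1.toSubmodule ≤ (l2OfForms (gl n K) μ π.1.W).topologicalClosure := by
    have := AutomorphicRepsGL.le_topologicalClosure_l2OfForms_formsOfL2
      (AutomorphicRepsGL.formsOfL2_ne_bot_holds hcpt μ)
      (AutomorphicRepsGL.formsOfL2_isStableSubmodule_holds hcpt μ)
      (AutomorphicRepsGL.formsOfL2_closure_exp_invariant_holds hcpt μ) P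
    rwa [← hW] at this
  -- the bilinear form on `W`, and on `W / ⊥`
  let B₀ : π.1.W →ₗ[ℂ] π.1.W →ₗ[ℂ] ℂ := LinearMap.mk₂ ℂ (fun x y => ⟪J (hL.cl x), hL.cl y⟫_ℂ)
      (fun x x' y => by simp only [map_add, hJadd, inner_add_left])
      (fun a x y => by
        simp only [map_smul, hJsmul, inner_smul_left, starRingEnd_self_apply, smul_eq_mul])
      (fun x y y' => by simp only [map_add, inner_add_right])
      (fun a x y => by simp only [map_smul, inner_smul_right, smul_eq_mul])
  have hB₀ : ∀ x y : π.1.W, B₀ x y = ⟪J (hL.cl x), hL.cl y⟫_ℂ := fun x y => rfl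
  have hker : π.1.kerQuot = ⊥ := by
    rw [AutomorphicRepData.kerQuot, h0, Submodule.comap_bot, Submodule.ker_subtype]
  let e : π.1.Quot ≃ₗ[ℂ] π.1.W := Submodule.quotEquivOfEqBot _ hker
  have he : ∀ x : π.1.W, e (π.1.mkQ x) = x := fun x =>
    Submodule.quotEquivOfEqBot_apply_mk (p := π.1.kerQuot) hker x
  let B : π.1.Quot →ₗ[ℂ] π.1.Quot →ₗ[ℂ] ℂ := B₀.compl₁₂ e.toLinearMap e.toLinearMap
  have hB : ∀ x y : π.1.W, B (π.1.mkQ x) (π.1.mkQ y) = ⟪J (hL.cl x), hL.cl y⟫_ℂ := fun x y => by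
    simp only [B, LinearMap.compl₁₂_apply, LinearEquiv.coe_coe, he, hB₀]
  have hmk0 : ∀ x : π.1.W, π.1.mkQ x = 0 → x = 0 := fun x hx => by
    rw [Submodule.mkQ_apply, Submodule.Quotient.mk_eq_zero, hker, Submodule.mem_bot] at hx
    exact hx
  have hcl0 : ∀ x : π.1.W, hL.cl x = 0 → x = 0 := fun x hx =>
    hL.cl_injective (by rw [hx, map_zero])
  -- classes of `W` pair as the forms do
  have hBcl : ∀ (x : π.1.W) (u : (gl n K).L2 μ), u ∈ l2OfForms (gl n K) μ π.1.W →
      ∃ y : π.1.W, hL.cl y = u := by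
    rintro x u ⟨f, hf, rfl, hfW⟩
    exact ⟨⟨_, hfW⟩, hL.cl_eq_toLp hf rfl⟩
  refine ⟨B, ?_, ?_, ?_, ?_, ?_⟩
  · -- non-degeneracy in the first variable
    intro x hx
    obtain ⟨x, rfl⟩ := π.1.kerQuot.mkQ_surjective x
    by_contra hall
    push Not at hall
    have hx0 : x ≠ 0 := fun h => hx (by rw [h, map_zero])
    have hJx : J (hL.cl x) ∈ P.1 := hJmem _ (hclP x)
    have horth : ∀ u : (gl n K).L2 μ, u ∈ l2OfForms (gl n K) μ π.1.W →
        ⟪J (hL.cl x), u⟫_ℂ = 0 := by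
      intro u hu
      obtain ⟨y, rfl⟩ := hBcl x u hu
      rw [← hB]
      exact hall _
    have h3 : J (hL.cl x) = 0 :=
      eq_zero_of_inner_eq_zero_of_mem_topologicalClosure _ _ horth (hdense hJx)
    exact hx0 (hcl0 x (hJinj _ h3))
  · -- non-degeneracy in the second variable
    intro y hy
    obtain ⟨y, rfl⟩ := π.1.kerQuot.mkQ_surjective y
    by_contra hall
    push Not at hall
    have hy0 : y ≠ 0 := fun h => hy (by rw [h, map_zero])
    have horth : ∀ u : (gl n K).L2 μ, u ∈ l2OfForms (gl n K) μ π.1.W →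
        ⟪hL.cl y, J u⟫_ℂ = 0 := by
      intro u hu
      obtain ⟨x, rfl⟩ := hBcl y u hu
      rw [inner_eq_zero_symm, ← hB]
      exact hall _
    obtain ⟨z, hz, hzy⟩ := hJsurj _ (hclP y)
    have h1 : ⟪hL.cl y, hL.cl y⟫_ℂ = 0 := by
      have h2 := inner_apply_eq_zero_of_mem_topologicalClosure J hJadd hJsmul hJcont _ _ horth
        (hdense hz)
      rwa [hzy] at h2
    exact hy0 (hcl0 y (inner_self_eq_zero.1 h1))
  · -- invariance under `(σ g, g)`, `g ∈ G(𝔸_f)`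
    intro g hg hσg x y
    obtain ⟨x, rfl⟩ := π.1.kerQuot.mkQ_surjective x
    obtain ⟨y, rfl⟩ := π.1.kerQuot.mkQ_surjective y
    have e1 : π.1.finiteRep ⟨σ • g, hσg⟩ (π.1.mkQ x) =
        π.1.mkQ ⟨rightTranslation (gl n K) (σ • g) x, π.1.stable.finite_stable _ hσg x.2⟩ := rfl
    have e2 : π.1.finiteRep ⟨g, hg⟩ (π.1.mkQ y) =
        π.1.mkQ ⟨rightTranslation (gl n K) g y, π.1.stable.finite_stable _ hg y.2⟩ := rfl
    rw [e1, e2, hB, hB, hclR, hclR, hJR, detTwist_one]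
    simp only [MonoidHom.one_apply, Units.val_one, one_mul]
    exact ((gl n K).rightRegularIsometry μ g).inner_map_map _ _
  · -- invariance under `(k', k)`, `k' = σ k` in `GL_n(𝔸_K)`
    intro k k' hkk' x y
    obtain ⟨x, rfl⟩ := π.1.kerQuot.mkQ_surjective x
    obtain ⟨y, rfl⟩ := π.1.kerQuot.mkQ_surjective y
    have e1 : π.1.kRep k' (π.1.mkQ x) =
        π.1.mkQ ⟨rightTranslation (gl n K) ((AutomorphyDatum.gl n K hcpt).ofK k') x, π.1.stable.k_stable k' x.2⟩ := rfl
    have e2 : π.1.kRep k (π.1.mkQ y) =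
        π.1.mkQ ⟨rightTranslation (gl n K) ((AutomorphyDatum.gl n K hcpt).ofK k) y, π.1.stable.k_stable k y.2⟩ := rfl
    rw [e1, e2, hB, hB, hclR, hclR, detTwist_one, hkk', hJR]
    simp only [MonoidHom.one_apply, Units.val_one, one_mul]
    exact ((gl n K).rightRegularIsometry μ _).inner_map_map _ _
  · -- the infinitesimal clause: `B(X' ψ, φ) + B(ψ, X φ) = 0` when `exp tX' = σ exp tX`
    intro X X' hXX' d hd ψ φ
    have hd0 : d = 0 := by
      have hconst : (fun t : ℝ => ((detTwist n (1 : HeckeCharacter K)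
          ((AutomorphyDatum.gl n K hcpt).ofArch ((AutomorphyDatum.gl n K hcpt).arch.expMem (t • X))) : ℂˣ) : ℂ)) = fun _ => 1 := by
        funext t
        rw [detTwist_one]
        simp only [MonoidHom.one_apply, Units.val_one]
      rw [hconst] at hd
      exact hd.unique (hasDerivAt_const (0 : ℝ) (1 : ℂ))
    rw [hd0, zero_mul, hB, hB]
    have hH : (AutomorphyDatum.gl n K hcpt).arch.lie = ⊤ := archGroupGL_lie n K
    have hc : (AutomorphyDatum.gl n K hcpt).arch.carrier = ⊤ := archGroupGL_carrier n K
    have hlie : ∀ (Y : (AutomorphyDatum.gl n K hcpt).arch.lie) (θ : π.1.W),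
        π.1.lieDerivW Y θ = hL.isLieStableSmooth.lieRep hH hc Y θ := fun Y θ => Subtype.ext rfl
    rw [hlie, hlie]
    have hu := hL.hasDerivAt_rightRegular_cl hH hc X' ψ
    have hv := hL.hasDerivAt_rightRegular_cl hH hc X φ
    -- `J` as a real continuous linear map
    let Jℝ : (gl n K).L2 μ →L[ℝ] (gl n K).L2 μ :=
      { toFun := J
        map_add' := hJadd
        map_smul' := fun r f => by
          rw [RingHom.id_apply, RCLike.real_smul_eq_coe_smul (K := ℂ) r f, hJsmul,
            RCLike.conj_ofReal, RCLike.real_smul_eq_coe_smul (K := ℂ) r (J f)]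
        cont := hJcont }
    have hJu : HasDerivAt (fun t : ℝ => J ((gl n K).rightRegular μ
        ((AutomorphyDatum.gl n K hcpt).ofArch ((AutomorphyDatum.gl n K hcpt).arch.expMem (t • X'))) (hL.cl ψ)))
        (J (hL.cl (hL.isLieStableSmooth.lieRep hH hc X' ψ))) 0 :=
      Jℝ.hasFDerivAt.comp_hasDerivAt (0 : ℝ) hu
    have hw_eq : (fun t : ℝ => J ((gl n K).rightRegular μ
        ((AutomorphyDatum.gl n K hcpt).ofArch ((AutomorphyDatum.gl n K hcpt).arch.expMem (t • X'))) (hL.cl ψ))) =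
        fun t => (gl n K).rightRegular μ ((AutomorphyDatum.gl n K hcpt).ofArch ((AutomorphyDatum.gl n K hcpt).arch.expMem (t • X))) (J (hL.cl ψ)) := by
      funext t
      rw [hXX' t, hJR]
    rw [hw_eq] at hJu
    have hwv := hJu.inner ℂ hv
    have e0 : (gl n K).rightRegular μ ((AutomorphyDatum.gl n K hcpt).ofArch ((AutomorphyDatum.gl n K hcpt).arch.expMem ((0 : ℝ) • X))) = 1 := by
      rw [RealMatrixGroup.expMem_zero_smul, map_one, map_one]
    simp only [e0, one_apply_eq_self] at hwv
    have hconst : (fun t : ℝ => ⟪(gl n K).rightRegular μ ((AutomorphyDatum.gl n K hcpt).ofArch ((AutomorphyDatum.gl n K hcpt).arch.expMem (t • X))) (J (hL.cl ψ)),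
        (gl n K).rightRegular μ ((AutomorphyDatum.gl n K hcpt).ofArch ((AutomorphyDatum.gl n K hcpt).arch.expMem (t • X))) (hL.cl φ)⟫_ℂ) =
        fun _ => ⟪J (hL.cl ψ), hL.cl φ⟫_ℂ := by
      funext t
      exact ((gl n K).rightRegularIsometry μ _).inner_map_map _ _
    have hzero : HasDerivAt (fun t : ℝ => ⟪(gl n K).rightRegular μ ((AutomorphyDatum.gl n K hcpt).ofArch ((AutomorphyDatum.gl n K hcpt).arch.expMem (t • X)))
        (J (hL.cl ψ)), (gl n K).rightRegular μ ((AutomorphyDatum.gl n K hcpt).ofArch ((AutomorphyDatum.gl n K hcpt).arch.expMem (t • X))) (hL.cl φ)⟫_ℂ) 0 0 := by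
      rw [hconst]
      exact hasDerivAt_const 0 _
    have huniq := hwv.unique hzero
    rwa [add_comm] at huniq

end Pairing

/-! ### 2. Transfer of the pairing form along a clean model `C / ⊥ ≅ W / W'` -/

section Transfer

variable {n : ℕ} {K : Type} [Field K] [NumberField K] {hcpt : isCompact_glFiniteIntegralLevel n K}
variable {F : Type*} [Field F] [Algebra F K]

-- five clauses transported through `quotEquiv`; the default heartbeat budget does not suffice
set_option maxHeartbeats 400000 in
/-- **Essential `σ`-conjugate self-duality transfers along a shift realisation.** If the clean
datum `π₀ = C / ⊥` realises `π = W / W'` along `N = S_μ^j` (`IsShiftRealisation`, the clean model of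
Borel–Jacquet 1979, 4.6 and 5.7 as packaged in `AutomorphicRepsGLShiftRealisation`: `c = N x ↦ [x]`
is an isomorphism `C / ⊥ ≅ W / W'` of `(𝔤, K_∞) × GL_n(𝔸_K^∞)`-modules, `quotEquiv`), then a
pairing witnessing `π₀^σ ≅ π₀^∨ ⊗ (χ ∘ det)` transports to one witnessing `π^σ ≅ π^∨ ⊗ (χ ∘ det)`:
`B(u, v) = B₀(e⁻¹ u, e⁻¹ v)`; the three invariance clauses follow because `N` commutes with right
translations (`shiftPow_rightTranslation`) and with the Lie derivatives (`hasLieAction_conjBy`),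
and non-degeneracy is preserved by the linear isomorphism `e`. [cite: BorelJacquetCorvallis1979, §4.6 and 5.7] -/
theorem AutomorphicRepData.IsShiftRealisation.isGalConjEssSelfDual
    {π π₀ : AutomorphicRepData (AutomorphyDatum.gl n K hcpt)} {μ : ℂ} {j : ℕ}
    {M : Submodule ℂ ((gl n K).Adelic → ℂ)} (h : π.IsShiftRealisation π₀ μ j M)
    {σ : K ≃ₐ[F] K} {χ : HeckeCharacter K} (h₀ : π₀.IsGalConjEssSelfDual σ χ) :
    π.IsGalConjEssSelfDual σ χ := by
  classical
  obtain ⟨B₀, hl, hr, hfin, hK, hLie⟩ := h₀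
  let B : π.Quot →ₗ[ℂ] π.Quot →ₗ[ℂ] ℂ := B₀.compl₁₂ h.quotEquiv.symm.toLinearMap h.quotEquiv.symm.toLinearMap
  have hB : ∀ u v, B u v = B₀ (h.quotEquiv.symm u) (h.quotEquiv.symm v) := fun u v => rfl
  -- every class of `π` is `[x]` with `x ∈ M`, and `e⁻¹ [x] = [N x]₀`
  have hrep : ∀ u : π.Quot, ∃ (x : (gl n K).Adelic → ℂ) (hx : x ∈ M)
      (hc : shiftPow hcpt μ j x ∈ π₀.W),
      u = π.mkQ ⟨x, h.M_le hx⟩ ∧ h.quotEquiv.symm u = π₀.mkQ ⟨shiftPow hcpt μ j x, hc⟩ := by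
    intro u
    obtain ⟨c, hc⟩ := π₀.kerQuot.mkQ_surjective (h.quotEquiv.symm u)
    obtain ⟨x, hx, hxc⟩ := h.exists_eq c c.2
    have hc' : shiftPow hcpt μ j x ∈ π₀.W := by rw [hxc]; exact c.2
    have hcx : c = ⟨shiftPow hcpt μ j x, hc'⟩ := Subtype.ext hxc.symm
    refine ⟨x, hx, hc', ?_, ?_⟩
    · rw [← h.quotEquiv_mkQ_eq hx hc', ← hcx, hc, LinearEquiv.apply_symm_apply]
    · rw [← hc, hcx]
  -- `e⁻¹` intertwines right translations by `G(𝔸_f)` and by `K_∞`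
  have htr : ∀ (g : (gl n K).Adelic) (hgM : ∀ x ∈ M, rightTranslation (gl n K) g x ∈ M)
      (hgW : ∀ x ∈ π.W, rightTranslation (gl n K) g x ∈ π.W)
      (hgW₀ : ∀ x ∈ π₀.W, rightTranslation (gl n K) g x ∈ π₀.W) (u : π.Quot)
      (x : (gl n K).Adelic → ℂ) (hx : x ∈ M) (hc : shiftPow hcpt μ j x ∈ π₀.W),
      u = π.mkQ ⟨x, h.M_le hx⟩ → h.quotEquiv.symm u = π₀.mkQ ⟨shiftPow hcpt μ j x, hc⟩ →
      h.quotEquiv.symm (π.mkQ ⟨rightTranslation (gl n K) g x, hgW x (h.M_le hx)⟩) =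
        π₀.mkQ ⟨rightTranslation (gl n K) g (shiftPow hcpt μ j x), hgW₀ _ hc⟩ := by
    intro g hgM hgW hgW₀ u x hx hc hu hsu
    have hgx : rightTranslation (gl n K) g x ∈ M := hgM x hx
    have hNgx : shiftPow hcpt μ j (rightTranslation (gl n K) g x) ∈ π₀.W := by
      rw [shiftPow_rightTranslation]
      exact hgW₀ _ hc
    rw [LinearEquiv.symm_apply_eq]
    have key := h.quotEquiv_mkQ_eq hgx hNgx
    have hNeq : (⟨shiftPow hcpt μ j (rightTranslation (gl n K) g x), hNgx⟩ : π₀.W) =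
        ⟨rightTranslation (gl n K) g (shiftPow hcpt μ j x), hgW₀ _ hc⟩ :=
      Subtype.ext (shiftPow_rightTranslation μ j g x)
    rw [hNeq] at key
    exact key.symm
  have hfr : ∀ (g : (gl n K).Adelic) (hg : g ∈ (AutomorphyDatum.gl n K hcpt).finiteAdelic)
      (u : π.Quot), h.quotEquiv.symm (π.finiteRep ⟨g, hg⟩ u) = π₀.finiteRep ⟨g, hg⟩ (h.quotEquiv.symm u) := by
    intro g hg u
    obtain ⟨x, hx, hc, hu, hsu⟩ := hrep u
    have key := htr g (fun x hx => h.stableM.finite_stable g hg hx)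
      (fun x hx => π.stable.finite_stable g hg hx) (fun x hx => π₀.stable.finite_stable g hg hx)
      u x hx hc hu hsu
    subst hu
    rw [hsu]
    exact key
  have hkr : ∀ (k : (AutomorphyDatum.gl n K hcpt).arch.maximalCompact) (u : π.Quot),
      h.quotEquiv.symm (π.kRep k u) = π₀.kRep k (h.quotEquiv.symm u) := by
    intro k u
    obtain ⟨x, hx, hc, hu, hsu⟩ := hrep u
    have key := htr ((AutomorphyDatum.gl n K hcpt).ofK k) (fun x hx => h.stableM.k_stable k hx)
      (fun x hx => π.stable.k_stable k hx) (fun x hx => π₀.stable.k_stable k hx) u x hx hc hu hsu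
    subst hu
    rw [hsu]
    exact key
  -- the Lie algebra actions correspond under `e`
  have hLieT : ∀ (X : (AutomorphyDatum.gl n K hcpt).arch.lie) (ψ : π.W) (c : π₀.W),
      π₀.mkQ c = h.quotEquiv.symm (π.mkQ ψ) → h.quotEquiv.symm (π.mkQ (π.lieDerivW X ψ)) = π₀.mkQ (π₀.lieDerivW X c) := by
    intro X ψ c hcψ
    have h1 : π.mkQ (π.lieDerivW X ψ) = π.lieRep X (π.mkQ ψ) := (π.hasLieAction_lieRep X ψ).symm
    have h2 := h.hasLieAction_conjBy π.hasLieAction_lieRep X c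
    rw [LieHom.conjBy_apply, LinearEquiv.symm_symm, hcψ, LinearEquiv.apply_symm_apply] at h2
    rw [h1]
    exact h2
  refine ⟨B, ?_, ?_, ?_, ?_, ?_⟩
  · intro u hu
    have hu' : h.quotEquiv.symm u ≠ 0 := fun h0 => hu (by simpa using congrArg h.quotEquiv h0)
    obtain ⟨y₀, hy₀⟩ := hl _ hu'
    refine ⟨h.quotEquiv y₀, ?_⟩
    rw [hB, LinearEquiv.symm_apply_apply]
    exact hy₀
  · intro v hv
    have hv' : h.quotEquiv.symm v ≠ 0 := fun h0 => hv (by simpa using congrArg h.quotEquiv h0)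
    obtain ⟨x₀, hx₀⟩ := hr _ hv'
    refine ⟨h.quotEquiv x₀, ?_⟩
    rw [hB, LinearEquiv.symm_apply_apply]
    exact hx₀
  · intro g hg hσg u v
    rw [hB, hB, hfr, hfr]
    exact hfin g hg hσg _ _
  · intro k k' hkk' u v
    rw [hB, hB, hkr, hkr]
    exact hK k k' hkk' _ _
  · intro X X' hXX' d hd ψ φ
    obtain ⟨c, hc⟩ := π₀.kerQuot.mkQ_surjective (h.quotEquiv.symm (π.mkQ ψ))
    obtain ⟨c', hc'⟩ := π₀.kerQuot.mkQ_surjective (h.quotEquiv.symm (π.mkQ φ))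
    have hc0 : π₀.mkQ c = h.quotEquiv.symm (π.mkQ ψ) := hc
    have hc0' : π₀.mkQ c' = h.quotEquiv.symm (π.mkQ φ) := hc'
    rw [hB, hB, hB, hLieT X' ψ c hc0, hLieT X φ c' hc0', ← hc0, ← hc0']
    exact hLie X X' hXX' d hd c c'

end Transfer

/-! ### 3. The normalising exponent vanishes and `U_c(Π) = Π̄`, from the almost-everywhere
conjugate self-duality and strong multiplicity one -/

section Normalisation

variable {n : ℕ} {K : Type} [Field K] [NumberField K] {hcpt : isCompact_glFiniteIntegralLevel n K}

open Literature.NumberTheory.GaloisRepresentations (ideleGroup ideleNorm)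

/-- If `exp (x a) = 1` for every real `x` then `a = 0` (differentiate at `x = 0`); as in
`StrongMultiplicityOneRepDataAE`, where it is private. [folklore] -/
private theorem eq_zero_of_forall_exp_ofReal_mul_eq_one' {a : ℂ}
    (h : ∀ x : ℝ, Complex.exp ((x : ℂ) * a) = 1) : a = 0 := by
  have h1 : HasDerivAt (fun y : ℂ => Complex.exp (y * a))
      (Complex.exp ((((0 : ℝ) : ℂ)) * a) * a) (((0 : ℝ) : ℂ)) :=
    (hasDerivAt_mul_const a).cexp
  have h2 : HasDerivAt (fun x : ℝ => Complex.exp ((x : ℂ) * a))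
      (Complex.exp ((((0 : ℝ) : ℂ)) * a) * a) 0 := h1.comp_ofReal
  have hfun : (fun x : ℝ => Complex.exp ((x : ℂ) * a)) = fun _ => (1 : ℂ) := funext h
  rw [hfun] at h2
  have h3 : Complex.exp ((((0 : ℝ) : ℂ)) * a) * a = 0 := h2.unique (hasDerivAt_const (0 : ℝ) (1 : ℂ))
  exact (mul_eq_zero.1 h3).resolve_left (Complex.exp_ne_zero _)

/-- `‖ϖ_v‖^t = q_v^{-t}`: the value at `v` of `χ = ‖·‖_𝔸^t` is `((q_v : ℂ)^t)⁻¹`; as in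
`StrongMultiplicityOneRepDataAE`, where it is private. [folklore] -/
private theorem valueAtUniformizer_of_ideleNorm_cpow {χ : HeckeCharacter K} {t : ℂ}
    (hχ : ∀ x : ideleGroup K, ((χ x : ℂˣ) : ℂ) = (ideleNorm x : ℂ) ^ t)
    (v : HeightOneSpectrum (𝓞 K)) :
    χ.valueAtUniformizer v = (((v.residueCard : ℂ)) ^ t)⁻¹ := by
  have hi : (1 : ℕ) ≤ 1 := le_rfl
  have h := ideleNorm_det_heckeDiagAt (n := 1) (K := K)
    (GaloisRepresentations.HeckeCharacter.valued_uniformizer v) hi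
  rw [det_heckeDiagAt v _ hi, pow_one, pow_one] at h
  rw [GaloisRepresentations.HeckeCharacter.valueAtUniformizer,
    GaloisRepresentations.HeckeCharacter.localComponent_apply, hχ, h, Complex.ofReal_inv,
    Complex.ofReal_natCast, Complex.inv_cpow _ _ (by rw [Complex.natCast_arg]; exact Real.pi_ne_zero.symm)]

/-- The twisting factor of a Satake parameter at exponent `0` is trivial:
`{q_v^{-0} a} = {a}`. [folklore] -/
private theorem map_residueCard_cpow_neg_zero_mul (v : HeightOneSpectrum (𝓞 K)) (α : Multiset ℂ) :
    α.map (fun x => (v.residueCard : ℂ) ^ (-(0 : ℂ)) * x) = α := by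
  rw [neg_zero, Complex.cpow_zero]
  simp only [one_mul, Multiset.map_id']

/-- Multiplication by the trivial character is the identity. [folklore] -/
private theorem mulChar_one_eq_id {G : Type*} [Group G] : mulChar (1 : G →* ℂˣ) = LinearMap.id := by
  refine LinearMap.ext fun φ => funext fun g => ?_
  simp [mulChar]

-- one long elaboration following `W_eq_of_isNearlyEquivalent_of_clean_of_smo` verbatim
set_option maxHeartbeats 800000 in
/-- **An almost-everywhere conjugate self-dual clean cuspidal datum is unitary (`s = 0`) and its
`L²`-realisation satisfies `U_c(Π) = Π̄`, granting strong multiplicity one.** Let `K` be a CM field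
with complex conjugation `c`, `π₀ = W₀ / ⊥` a clean cuspidal Borel–Jacquet datum on `GL_n(𝔸_K)`
(`n ≥ 1`) with `Sat(π₀, c w) = Sat(π₀, w)⁻¹` for almost all `w` (`IsConjSelfDualAE`), and `μ` an
automorphic measure (Galois invariant, `hgal`). Normalise `W₀ ⊗ |det|^s = V_Π`, `Π ⊂ L²_cusp(μ)`
(`exists_twist_eq_formsOfL2_of_clean_eventually`, Borel–Jacquet 1979, 5.7). Then
(1) `s = 0`: the central characters `ω` of `Π` and `ω_c` of `U_c(Π)` (`exists_centralCharacter`;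
`t_{U_c(Π), w} = t_{Π, c w}`, `HasSatakeParameterAt.galConj_principalCongruenceLevel`) satisfy
`(ω ω_c)(ϖ_w) = q_w^{-ns} ∏α_w · q_w^{-ns} ∏α_w⁻¹ = q_w^{-2ns}` at almost every `w`, so
`ω ω_c = ‖·‖^{2ns}` (`HeckeCharacter.ext_of_eventually_valueAtUniformizer_eq`), and both are trivial
on `A_G`, whence `r^{2ns[K:ℚ]} = 1` for all `r > 0`, i.e. `s = 0`; hence `χ = 1` and `W₀ = V_Π`;
(2) `U_c(Π)` and `Π̄` have the same Satake parameter `t_{Π,w}⁻¹` at the local spherical level at almost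
every `w` — `t_{U_c(Π), w} = t_{Π, c w} = t_{Π,w}⁻¹` by hypothesis and `t_{Π̄, w} = \bar t_{Π,w} = t_{Π,w}⁻¹`
by the unitarity of the unramified local components of `Π ⊂ L²` (`HasSatakeParameterAt.conj`,
`HasSatakeParameterAt.map_conj_inv_eq`) — so `U_c(Π) = Π̄` by `strong_multiplicity_one_gl_sphericalLevel`
(Jacquet–Shalika 1981, Thm. 4.4 with multiplicity one: Piatetski-Shapiro 1979), the only unproved
input. [cite: JacquetShalikaAJM1981II, Thm. 4.4] [cite: PiatetskiShapiroCorvallis1979]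
[cite: BorelJacquetCorvallis1979, 5.7] -/
theorem CuspidalAutomorphicRepData.exists_eq_formsOfL2_galConj_eq_conj_of_smo [NeZero n]
    [IsCMField K] {μ : Measure (gl n K).automorphicQuotient} [(gl n K).IsAutomorphicMeasure μ]
    (hgal : IsGalInvariant (maximalRealSubfield K) μ)
    (hsmo : strong_multiplicity_one_gl_sphericalLevel n K)
    (π₀ : CuspidalAutomorphicRepData n K hcpt) (h0 : π₀.1.W' = ⊥)
    (hAE : π₀.1.IsConjSelfDualAE (IsCMField.complexConj K)) :
    ∃ P : CuspidalAutomorphicRepGL n K μ, π₀.1.W = formsOfL2 hcpt μ P.1 ∧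
      P.galConj (maximalRealSubfield K) hgal (IsCMField.complexConj K) = P.conj := by
  classical
  set c : K ≃ₐ[maximalRealSubfield K] K := IsCMField.complexConj K with hcdef
  have hcc : c * c = 1 := by ext x; simp [hcdef]
  have hccw : ∀ w : HeightOneSpectrum (𝓞 K), c • c • w = w := fun w => by
    rw [smul_smul, hcc, one_smul]
  obtain ⟨s, χ, P, hχ, hW, hSat⟩ := π₀.exists_twist_eq_formsOfL2_of_clean_eventually (μm := μ) h0
  set Q : CuspidalAutomorphicRepGL n K μ := P.galConj (maximalRealSubfield K) hgal c with hQdef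
  have hq : ∀ v : HeightOneSpectrum (𝓞 K), (v.residueCard : ℂ) ≠ 0 := fun v => by
    have := v.one_lt_residueCard
    exact_mod_cast (by omega : v.residueCard ≠ 0)
  -- the good places: `π₀` unramified at `w` and `c w`, Satake clause at `w` and `c w`, hypothesis at `w`
  have hcof : ∀ᶠ w : HeightOneSpectrum (𝓞 K) in cofinite, π₀.1.IsUnramifiedAt w :=
    AutomorphicRepData.hasSatakeParamAt_cofinite_holds π₀.1
  have htend : Tendsto (fun w : HeightOneSpectrum (𝓞 K) => c • w) cofinite cofinite :=
    (MulAction.injective c).tendsto_cofinite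
  have hAE' : ∀ᶠ w : HeightOneSpectrum (𝓞 K) in cofinite, ∀ α β : Multiset ℂ,
      π₀.1.HasSatakeParamAt w α → π₀.1.HasSatakeParamAt (c • w) β → β = α.map (·⁻¹) := hAE
  have hgood : ∀ᶠ w : HeightOneSpectrum (𝓞 K) in cofinite,
      ((π₀.1.IsUnramifiedAt w ∧ π₀.1.IsUnramifiedAt (c • w)) ∧
      ((∀ α : Multiset ℂ, π₀.1.HasSatakeParamAt w α →
        ∃ (𝔫 : Ideal (𝓞 K)) (ϖ : (w.adicCompletion K)ˣ), 𝔫 ≠ 0 ∧ ¬ w.asIdeal ∣ 𝔫 ∧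
          HasSatakeParameterAt P.1 (principalCongruenceLevel n K 𝔫) w ϖ
            (α.map (((w.residueCard : ℂ) ^ (-s)) * ·))) ∧
       (∀ α : Multiset ℂ, π₀.1.HasSatakeParamAt (c • w) α →
        ∃ (𝔫 : Ideal (𝓞 K)) (ϖ : ((c • w).adicCompletion K)ˣ), 𝔫 ≠ 0 ∧ ¬ (c • w).asIdeal ∣ 𝔫 ∧
          HasSatakeParameterAt P.1 (principalCongruenceLevel n K 𝔫) (c • w) ϖ
            (α.map ((((c • w).residueCard : ℂ) ^ (-s)) * ·))))) ∧
      (∀ α β : Multiset ℂ, π₀.1.HasSatakeParamAt w α → π₀.1.HasSatakeParamAt (c • w) β →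
        β = α.map (·⁻¹)) :=
    ((hcof.and (htend.eventually hcof)).and (hSat.and (htend.eventually hSat))).and hAE'
  -- the Satake data of `Q = U_c(Π)` at `w`, read off those of `Π` at `c w`
  have hQsat : ∀ (w : HeightOneSpectrum (𝓞 K)) {𝔫 : Ideal (𝓞 K)} {ϖ : ((c • w).adicCompletion K)ˣ}
      {γ : Multiset ℂ}, 𝔫 ≠ 0 → ¬ (c • w).asIdeal ∣ 𝔫 →
      HasSatakeParameterAt P.1 (principalCongruenceLevel n K 𝔫) (c • w) ϖ γ →
      ∃ (𝔪 : Ideal (𝓞 K)) (ϖ'' : (w.adicCompletion K)ˣ), 𝔪 ≠ 0 ∧ ¬ w.asIdeal ∣ 𝔪 ∧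
        HasSatakeParameterAt Q.1 (principalCongruenceLevel n K 𝔪) w ϖ'' γ := by
    intro w 𝔫 ϖ γ h𝔫 hw𝔫 hP
    have h1 := hP.galConj_principalCongruenceLevel (maximalRealSubfield K) hgal c
    have h𝔫' : c • 𝔫 ≠ 0 := by
      rw [Ne, Submodule.zero_eq_bot, Ideal.smul_eq_bot_iff, ← Submodule.zero_eq_bot]
      exact h𝔫
    have hdvd : ¬ (c • c • w).asIdeal ∣ c • 𝔫 := by
      rw [← pow_one (c • c • w).asIdeal, HeightOneSpectrum.smul_asIdeal_pow_dvd_smul_iff, pow_one]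
      exact hw𝔫
    have h2 : ∃ (𝔪 : Ideal (𝓞 K)) (ϖ'' : ((c • c • w).adicCompletion K)ˣ), 𝔪 ≠ 0 ∧
        ¬ (c • c • w).asIdeal ∣ 𝔪 ∧
        HasSatakeParameterAt Q.1 (principalCongruenceLevel n K 𝔪) (c • c • w) ϖ'' γ :=
      ⟨c • 𝔫, _, h𝔫', hdvd, h1⟩
    rw [hccw] at h2
    exact h2
  -- Step 1: `s = 0`, comparing the central characters of `Π` and `U_c(Π)` with `‖·‖^{2ns}`
  obtain ⟨ω, -, hωA, -, hωsat, -⟩ := P.exists_centralCharacter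
  obtain ⟨ω', -, hω'A, -, hω'sat, -⟩ := Q.exists_centralCharacter
  obtain ⟨ν, hν⟩ := exists_heckeCharacter_ideleNorm_cpow K (2 * ((n : ℂ) * s))
  have hval : ∀ᶠ w : HeightOneSpectrum (𝓞 K) in cofinite,
      (ω * ω').valueAtUniformizer w = ν.valueAtUniformizer w := by
    filter_upwards [hgood] with w hw
    obtain ⟨⟨⟨⟨α, hα⟩, ⟨β, hβ⟩⟩, ⟨hSw, hScw⟩⟩, hAEw⟩ := hw
    have hβα : β = α.map (·⁻¹) := hAEw α β hα hβ
    obtain ⟨𝔫, ϖ, h𝔫, hw𝔫, hPw⟩ := hSw α hα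
    obtain ⟨𝔫', ϖ', h𝔫', hw𝔫', hPcw⟩ := hScw β hβ
    obtain ⟨𝔪, ϖ'', h𝔪, hw𝔪, hQw⟩ := hQsat w h𝔫' hw𝔫' hPcw
    have hcard : Multiset.card α = n := hα.card_eq
    have hcard' : Multiset.card (α.map (·⁻¹)) = n := by rw [Multiset.card_map, hcard]
    have e1 : ω.valueAtUniformizer w = (w.residueCard : ℂ) ^ ((n : ℂ) * -s) * α.prod := by
      rw [(hωsat h𝔫 hw𝔫 hPw).2, Multiset.prod_map_mul, Multiset.map_const', Multiset.prod_replicate,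
        Multiset.map_id', hcard, Complex.cpow_nat_mul]
    have e2 : ω'.valueAtUniformizer w = (w.residueCard : ℂ) ^ ((n : ℂ) * -s) * (α.prod)⁻¹ := by
      rw [(hω'sat h𝔪 hw𝔪 hQw).2, hβα, HeightOneSpectrum.residueCard_smul, Multiset.prod_map_mul,
        Multiset.map_const', Multiset.prod_replicate, Multiset.map_id', hcard', Complex.cpow_nat_mul,
        Multiset.prod_map_inv, Multiset.map_id']
    have hne0 : ω.valueAtUniformizer w ≠ 0 := by
      simp only [GaloisRepresentations.HeckeCharacter.valueAtUniformizer]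
      exact Units.ne_zero _
    have hαprod : α.prod ≠ 0 := by
      intro h0p
      rw [e1, h0p, mul_zero] at hne0
      exact hne0 rfl
    have hprod : (ω * ω').valueAtUniformizer w =
        ω.valueAtUniformizer w * ω'.valueAtUniformizer w := by
      simp only [GaloisRepresentations.HeckeCharacter.valueAtUniformizer,
        GaloisRepresentations.HeckeCharacter.localComponent_apply,
        GaloisRepresentations.HeckeCharacter.mul_apply, Units.val_mul]
    rw [hprod, e1, e2, valueAtUniformizer_of_ideleNorm_cpow hν w,
      show ∀ X A : ℂ, X * A * (X * A⁻¹) = X * X * (A * A⁻¹) from fun _ _ => by ring,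
      mul_inv_cancel₀ hαprod, mul_one, ← Complex.cpow_add _ _ (hq w), ← Complex.cpow_neg]
    congr 1
    ring
  have hων : ω * ω' = ν :=
    GaloisRepresentations.HeckeCharacter.ext_of_eventually_valueAtUniformizer_eq hval
  -- evaluate on `A_G`: `1 = r^{[K:ℚ] 2 n s}` for all `r > 0`, so `s = 0`
  have hAval : ∀ r : ℝ≥0ˣ,
      ((((r : ℝ≥0) : ℝ) ^ Module.finrank ℚ K : ℝ) : ℂ) ^ (2 * ((n : ℂ) * s)) = 1 := by
    intro r
    have e := congrArg (fun η : HeckeCharacter K => ((η (posRealIdele K r) : ℂˣ) : ℂ)) hων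
    rw [GaloisRepresentations.HeckeCharacter.mul_apply, hωA r, hω'A r, mul_one, Units.val_one, hν,
      ← coe_ideleNorm, ideleNorm_posRealIdele_holds K r, NNReal.coe_pow] at e
    exact e.symm
  have hexp : ∀ x : ℝ, Complex.exp ((x : ℂ) * (2 * ((n : ℂ) * s))) = 1 := by
    intro x
    have hpos : 0 < Real.exp (x / Module.finrank ℚ K) := Real.exp_pos _
    let r : ℝ≥0ˣ := Units.mk0 ⟨Real.exp (x / Module.finrank ℚ K), hpos.le⟩
      (by rw [Ne, ← NNReal.coe_eq_zero]; exact hpos.ne')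
    have e := hAval r
    have hrx : ((((r : ℝ≥0) : ℝ) ^ Module.finrank ℚ K : ℝ)) = Real.exp x := by
      change (Real.exp (x / Module.finrank ℚ K)) ^ Module.finrank ℚ K = Real.exp x
      rw [← Real.exp_nat_mul]
      congr 1
      have hd : ((Module.finrank ℚ K : ℕ) : ℝ) ≠ 0 := by exact_mod_cast Module.finrank_pos.ne'
      field_simp
    rw [hrx, Complex.ofReal_exp, Complex.cpow_def_of_ne_zero (Complex.exp_ne_zero _),
      Complex.log_exp (by rw [Complex.ofReal_im]; linarith [Real.pi_pos])
        (by rw [Complex.ofReal_im]; exact Real.pi_pos.le)] at e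
    exact e
  have hw0 : 2 * ((n : ℂ) * s) = 0 := eq_zero_of_forall_exp_ofReal_mul_eq_one' hexp
  have hs0 : s = 0 := by
    have hn0 : (n : ℂ) ≠ 0 := Nat.cast_ne_zero.2 (NeZero.ne n)
    rcases mul_eq_zero.1 hw0 with h | h
    · exact absurd h two_ne_zero
    · rcases mul_eq_zero.1 h with h' | h'
      · exact absurd h' hn0
      · exact h'
  subst hs0
  -- hence `χ = 1` and `W₀ = V_Π`
  have hχ1 : χ = 1 :=
    GaloisRepresentations.HeckeCharacter.ext fun x => Units.ext (by
      rw [hχ x, Complex.cpow_zero, GaloisRepresentations.HeckeCharacter.one_apply, Units.val_one])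
  have hW₀ : π₀.1.W = formsOfL2 hcpt μ P.1 := by
    rw [← hW, hχ1, detTwist_one, mulChar_one_eq_id, Submodule.map_id]
  refine ⟨P, hW₀, ?_⟩
  -- Step 2: `U_c(Π) = Π̄` by strong multiplicity one at the local spherical levels
  obtain ⟨S₀, hS₀⟩ : ∃ S₀ : Finset (HeightOneSpectrum (𝓞 K)), ∀ w ∉ S₀,
      ((π₀.1.IsUnramifiedAt w ∧ π₀.1.IsUnramifiedAt (c • w)) ∧
      ((∀ α : Multiset ℂ, π₀.1.HasSatakeParamAt w α →
        ∃ (𝔫 : Ideal (𝓞 K)) (ϖ : (w.adicCompletion K)ˣ), 𝔫 ≠ 0 ∧ ¬ w.asIdeal ∣ 𝔫 ∧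
          HasSatakeParameterAt P.1 (principalCongruenceLevel n K 𝔫) w ϖ
            (α.map (((w.residueCard : ℂ) ^ (-(0 : ℂ))) * ·))) ∧
       (∀ α : Multiset ℂ, π₀.1.HasSatakeParamAt (c • w) α →
        ∃ (𝔫 : Ideal (𝓞 K)) (ϖ : ((c • w).adicCompletion K)ˣ), 𝔫 ≠ 0 ∧ ¬ (c • w).asIdeal ∣ 𝔫 ∧
          HasSatakeParameterAt P.1 (principalCongruenceLevel n K 𝔫) (c • w) ϖ
            (α.map ((((c • w).residueCard : ℂ) ^ (-(0 : ℂ))) * ·))))) ∧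
      (∀ α β : Multiset ℂ, π₀.1.HasSatakeParamAt w α → π₀.1.HasSatakeParamAt (c • w) β →
        β = α.map (·⁻¹)) := by
    refine ⟨(Filter.eventually_cofinite.mp hgood).toFinset, fun v hv => ?_⟩
    by_contra h
    exact hv ((Filter.eventually_cofinite.mp hgood).mem_toFinset.mpr h)
  have hsph : ∀ w ∉ S₀, ∃ β : Multiset ℂ,
      (∃ ϖ : (w.adicCompletion K)ˣ, HasSatakeParameterAt Q.1 (sphericalLevelAt K n w) w ϖ β) ∧
      (∃ ϖ : (w.adicCompletion K)ˣ, HasSatakeParameterAt P.conj.1 (sphericalLevelAt K n w) w ϖ β) := by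
    intro w hw
    obtain ⟨⟨⟨⟨α, hα⟩, ⟨β, hβ⟩⟩, ⟨hSw, hScw⟩⟩, hAEw⟩ := hS₀ w hw
    have hβα : β = α.map (·⁻¹) := hAEw α β hα hβ
    obtain ⟨𝔫, ϖ, h𝔫, hw𝔫, hPw⟩ := hSw α hα
    obtain ⟨𝔫', ϖ', h𝔫', hw𝔫', hPcw⟩ := hScw β hβ
    rw [map_residueCard_cpow_neg_zero_mul] at hPw hPcw
    obtain ⟨𝔪, ϖ'', h𝔪, hw𝔪, hQw⟩ := hQsat w h𝔫' hw𝔫' hPcw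
    -- `t_{Π̄, w} = \bar t_{Π, w} = t_{Π, w}⁻¹`
    have hconj : α.map (starRingEnd ℂ) = α.map (·⁻¹) := by
      conv_rhs => rw [← hPw.map_conj_inv_eq h𝔫 hw𝔫]
      rw [Multiset.map_map]
      exact (Multiset.map_congr rfl fun a _ => by simp).symm
    refine ⟨α.map (·⁻¹), ⟨ϖ'', ?_⟩, ⟨ϖ, ?_⟩⟩
    · rw [← hβα]
      exact hQw.sphericalLevelAt_of_principalCongruenceLevel h𝔪 hw𝔪
    · rw [← hconj]
      exact (hPw.conj).sphericalLevelAt_of_principalCongruenceLevel h𝔫 hw𝔫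
  have hiff : ∀ w ∉ S₀, ∀ (ϖ : (w.adicCompletion K)ˣ) (β : Multiset ℂ),
      HasSatakeParameterAt Q.1 (sphericalLevelAt K n w) w ϖ β ↔
        HasSatakeParameterAt P.conj.1 (sphericalLevelAt K n w) w ϖ β := by
    intro w hw ϖ β
    obtain ⟨β₀, ⟨ϖ₁, h₁⟩, ⟨ϖ₂, h₂⟩⟩ := hsph w hw
    constructor
    · intro h
      have hβ : β = β₀ := HasSatakeParameterAt.sphericalLevelAt_unique Q h h₁
      subst hβ
      exact h₂.of_valuation_eq (isMaximalAt_sphericalLevelAt n w) h.1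
    · intro h
      have hβ : β = β₀ := HasSatakeParameterAt.sphericalLevelAt_unique P.conj h h₂
      subst hβ
      exact h₁.of_valuation_eq (isMaximalAt_sphericalLevelAt n w) h.1
  haveI : Infinite (HeightOneSpectrum (𝓞 K)) := infinite_heightOneSpectrum K
  obtain ⟨w₀, hw₀⟩ := Infinite.exists_notMem_finset S₀
  have hex : ∃ w ∉ S₀, ∃ (ϖ : (w.adicCompletion K)ˣ) (β : Multiset ℂ),
      HasSatakeParameterAt Q.1 (sphericalLevelAt K n w) w ϖ β := by
    obtain ⟨β₀, ⟨ϖ₁, h₁⟩, -⟩ := hsph w₀ hw₀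
    exact ⟨w₀, hw₀, ϖ₁, β₀, h₁⟩
  exact hsmo μ Q P.conj S₀ hiff hex

end Normalisation

/-! ### 4. Assembly: the named fact from strong multiplicity one -/

section Assembly

variable {n : ℕ} {K : Type} [Field K] [NumberField K] {hcpt : isCompact_glFiniteIntegralLevel n K}

/-- **`Π^c ≅ Π^∨` almost everywhere on Satake parameters implies conjugate self-duality in the
pairing form, granting strong multiplicity one** (pointwise form of
`JacquetShalika1981_isEssConjSelfDual_of_isConjSelfDualAE`). For `K` CM, `n ≥ 1` and a cuspidal
Borel–Jacquet datum `P = W / W'` on `GL_n(𝔸_K)` with `Sat(P, c w) = Sat(P, w)⁻¹` for almost all `w`: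
take a clean model `π₀ = C / ⊥` realising `P` (`exists_isShiftRealisation_of_sSup_irreducible`,
Borel–Jacquet 1979, 4.6 and 5.7), which inherits the hypothesis (it has the Satake parameters of
`P`); by `exists_eq_formsOfL2_galConj_eq_conj_of_smo` its space of forms is `V_Π` for a cuspidal
`Π ⊂ L²_cusp` with `U_c(Π) = Π̄` (this is where Jacquet–Shalika's strong multiplicity one enters);
the `L²` pairing `⟪\overline{U_c [x]}, [y]⟫` makes `π₀` conjugate self-dual in the pairing form
(`isGalConjEssSelfDual_one_of_galConj_eq_conj`), and the pairing transports to `P` along `C / ⊥ ≅ W / W'`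
(`IsShiftRealisation.isGalConjEssSelfDual`). [cite: JacquetShalikaAJM1981II, Thm. 4.4]
[cite: PiatetskiShapiroCorvallis1979] -/
theorem CuspidalAutomorphicRepData.isEssConjSelfDual_one_of_isConjSelfDualAE_of_smo [NeZero n]
    [IsCMField K] (hsmo : strong_multiplicity_one_gl_sphericalLevel n K)
    (P : CuspidalAutomorphicRepData n K hcpt)
    (hP : P.1.IsConjSelfDualAE (IsCMField.complexConj K)) : P.1.IsEssConjSelfDual 1 := by
  classical
  obtain ⟨μ, hμ⟩ := AdelicGroupData.exists_isAutomorphicMeasure_gl_holds n K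
  haveI := hμ
  have hgal : IsGalInvariant (maximalRealSubfield K) μ :=
    isGalInvariant_of_unique (maximalRealSubfield K)
      (AdelicGroupData.isAutomorphicMeasure_unique_smul_holds n K) μ
  obtain ⟨π₀, μ', j, M, hsh⟩ :=
    P.exists_isShiftRealisation_of_sSup_irreducible AutomorphicRepsGL.stable_cuspidal_eq_sSup_irreducible_holds
  -- the clean model inherits the almost-everywhere conjugate self-duality
  have hAE : π₀.1.IsConjSelfDualAE (IsCMField.complexConj K) := by
    have hP' : ∀ᶠ w : HeightOneSpectrum (𝓞 K) in cofinite, ∀ α β : Multiset ℂ,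
        P.1.HasSatakeParamAt w α → P.1.HasSatakeParamAt (IsCMField.complexConj K • w) β →
          β = α.map (·⁻¹) := hP
    have : ∀ᶠ w : HeightOneSpectrum (𝓞 K) in cofinite, ∀ α β : Multiset ℂ,
        π₀.1.HasSatakeParamAt w α → π₀.1.HasSatakeParamAt (IsCMField.complexConj K • w) β →
          β = α.map (·⁻¹) := by
      filter_upwards [hP'] with w hw α β hα hβ
      exact hw α β (hsh.hasSatakeParamAt hα) (hsh.hasSatakeParamAt hβ)
    exact this
  obtain ⟨P₂, hW, hP₂⟩ := π₀.exists_eq_formsOfL2_galConj_eq_conj_of_smo hgal hsmo hsh.bot hAE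
  have hcc : IsCMField.complexConj K * IsCMField.complexConj K = 1 := by ext x; simp
  have h₀ : π₀.1.IsGalConjEssSelfDual (IsCMField.complexConj K) 1 :=
    CuspidalAutomorphicRepData.isGalConjEssSelfDual_one_of_galConj_eq_conj _ hcc hgal π₀ hsh.bot P₂ hW hP₂
  exact hsh.isGalConjEssSelfDual h₀

/-- **The named fact `JacquetShalika1981_isEssConjSelfDual_of_isConjSelfDualAE` follows from strong
multiplicity one for `GL_N` at the local spherical levels** (`strong_multiplicity_one_gl_sphericalLevel`,
Jacquet–Shalika 1981 II, Thm. 4.4 with multiplicity one, Piatetski-Shapiro 1979 — the tree's named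
fact, proved there for `N ≤ 1` only): every other input of the printed argument (the contragredient as
the conjugate `Π̄` of the unitary `Π`, `Π^c` as `U_c(Π)`, the `L²` pairing, the clean model) is a
theorem of the tree or of this file. [cite: JacquetShalikaAJM1981II, Thm. 4.4]
[cite: PiatetskiShapiroCorvallis1979] -/
theorem JacquetShalika1981_isEssConjSelfDual_of_isConjSelfDualAE_of_smo
    (hsmo : ∀ (N : ℕ) (K : Type) [Field K] [NumberField K],
      strong_multiplicity_one_gl_sphericalLevel N K) :
    JacquetShalika1981_isEssConjSelfDual_of_isConjSelfDualAE := by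
  intro N K _ _ _ hcpt P hN hP
  haveI : NeZero N := ⟨hN.ne'⟩
  exact P.isEssConjSelfDual_one_of_isConjSelfDualAE_of_smo (hsmo N K) hP

/-- In particular the fact holds unconditionally in rank `N = 1` (Hecke characters), where strong
multiplicity one is a theorem of the tree (`strong_multiplicity_one_gl_sphericalLevel_of_le_one`).
[cite: JacquetShalikaAJM1981II, Thm. 4.4] -/
theorem CuspidalAutomorphicRepData.isEssConjSelfDual_one_of_isConjSelfDualAE_rank_one [IsCMField K]
    {hcpt₁ : isCompact_glFiniteIntegralLevel 1 K} (P : CuspidalAutomorphicRepData 1 K hcpt₁)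
    (hP : P.1.IsConjSelfDualAE (IsCMField.complexConj K)) : P.1.IsEssConjSelfDual 1 :=
  P.isEssConjSelfDual_one_of_isConjSelfDualAE_of_smo
    (strong_multiplicity_one_gl_sphericalLevel_of_le_one K le_rfl) hP

end Assembly

end Literature.NumberTheory.Automorphic
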